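import Mathlib
import HarnessLib
import Literature.Analysis.PDE.DivFormStrongMaximumPrinciple
import Summits.NavierStokesRegularity.NavierStokesRegularity.Theorems.PoloidalWindowDoorPoloidalWindowRigidityDivFormCaccioppoli
import Summits.NavierStokesRegularity.NavierStokesRegularity.Theorems.PoloidalWindowDoorPoloidalWindowRigidityDivFormCaccioppoliPowers

/-!
# Route `PoloidalWindowDoor`, crux K2 (stmt-NavierStokesRegularity-19708) — LOCAL Caccioppoli inequalities for
# `div(a∇u) = 0` on an open set `U` (towards `divFormStrongMaximumPrinciple_holds`, GT Thm 8.19, and an interior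
# Harnack inequality for LOCAL weak solutions; De Giorgi–Nash–Moser)

The sibling files `…DivFormCaccioppoli`, `…DivFormCaccioppoliPowers` (seat ns-poloidal-K2-p3) prove the weighted
energy identity and the weighted / power / logarithmic Caccioppoli inequalities for ENTIRE weak solutions: their
hypothesis `hweak` asks `∫ Σᵢⱼ aᵢⱼ ∂ᵢu ∂ⱼη = 0` for EVERY `η ∈ C¹_c(ℝⁿ)`.  The named fact
`Literature.Analysis.PDE.divFormStrongMaximumPrinciple` (Gilbarg–Trudinger Thm 8.19) and the line stub it serves
(`Cruxes/PoloidalWindowRigidity/Lines/thread_type.lean`, C1) only have the equation LOCALLY: for test functions with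
`tsupport η ⊆ U`, `U` open.  This file re-runs the same five proofs VERBATIM with that weaker hypothesis; the only
change is that every cutoff `χ` now carries `tsupport χ ⊆ U`, so that the test function `η = χ² g(u)` is admissible
(`tsupport (χ² g(u)) ⊆ tsupport χ ⊆ U`).  As in the siblings, `u ∈ C¹(ℝⁿ)` with `u ≥ 1` globally and the coefficient
hypotheses are global (a local solution is put in this form by a cutoff modification OUTSIDE the ball of interest —
done once, in the strong-maximum-principle file); nothing is assumed about `u` off `U` beyond smoothness.

* `energy_identity_weighted_local` — `∫ χ² g′(u) Du·aDu = −2 ∫ χ g(u) Du·aDχ` for `χ ∈ C¹_c`, `tsupport χ ⊆ U`;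
* `caccioppoli_weighted_local` — `∫ χ² g′(u) Du·aDu ≤ 4 ∫ (g²/g′)(u) Dχ·aDχ` (`g′ > 0`);
* `caccioppoli_rpow_local` — weight `s^β/β` (Moser 1961 (4.4); Gilbarg–Trudinger (8.52));
* `caccioppoli_log_local` — weight `−1/s` (Moser 1961 §5): `∫ χ² u⁻² Du·aDu ≤ 4 ∫ Dχ·aDχ`
  (its gradient-norm form `gradLog_estimate` is localised in the sequel file on the logarithmic oscillation).

Adapted from `…DivFormCaccioppoli` / `…DivFormCaccioppoliPowers` (proofs copied, hypothesis localised); all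
algebraic and integrability helpers are imported from there, not restated.  Seat ns-in-ser-b g5 (cell pub/ns-inputs),
`ledger fact claim` #1 on `Literature.Analysis.PDE.divFormStrongMaximumPrinciple`.

WHAT THIS IS NOT: not yet a Harnack inequality or the strong maximum principle (sequel files: local reverse Hölder,
local Moser chain, the Bombieri–Giusti lemma, local Harnack, GT 8.19); nothing here is specific to Navier–Stokes and no
NS statement is touched.
-/

noncomputable section

open MeasureTheory Set Function Filter Topology Metric
open scoped Matrix

-- the summit and its single sub-problem share the name (CONVENTIONS §1), as in every Theorems file
set_option linter.dupNamespace false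

namespace Summit.NavierStokesRegularity.NavierStokesRegularity.Theorems.PoloidalWindowDoorPoloidalWindowRigidityDivFormLocalCaccioppoli

open Summit.NavierStokesRegularity.NavierStokesRegularity.Theorems.PoloidalWindowDoorPoloidalWindowRigidityDivFormCaccioppoli
open Summit.NavierStokesRegularity.NavierStokesRegularity.Theorems.PoloidalWindowDoorPoloidalWindowRigidityDivFormCaccioppoliPowers

variable {n : ℕ} {a : EuclideanSpace ℝ (Fin n) → Matrix (Fin n) (Fin n) ℝ} {lam Λ : ℝ}
  {u : EuclideanSpace ℝ (Fin n) → ℝ} {U : Set (EuclideanSpace ℝ (Fin n))}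

/-! ### Supports of the test functions -/

/-- `tsupport (χ²) ⊆ tsupport χ`. -/
theorem tsupport_sq_subset (χ : EuclideanSpace ℝ (Fin n) → ℝ) :
    tsupport (fun y => χ y ^ 2) ⊆ tsupport χ :=
  closure_mono fun y hy => by
    simp only [mem_support, ne_eq] at hy ⊢
    intro h; exact hy (by simp [h])

/-! ### The weighted energy identity and Caccioppoli inequality, local form -/

/-- **Weighted energy identity.**  Let `u ∈ C¹(ℝⁿ)`, `u ≥ 1`, be a weak solution (`∫ Σ aᵢⱼ ∂ᵢu ∂ⱼη = 0` for all
`η ∈ C¹_c`), `g ∈ C¹(]½,∞[)`, `χ ∈ C¹_c`.  Then, with `Du = (∂ᵢu)ᵢ`, `Dχ = (∂ⱼχ)ⱼ`,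
`∫ χ² g′(u) Du·a Du = −2 ∫ χ g(u) Du·a Dχ`. -/
theorem energy_identity_weighted_local (hsymm : ∀ y, (a y).IsSymm) (hlam : 0 < lam)
    (hmeas : ∀ i j, Measurable fun y => a y i j)
    (hell : ∀ y (ξ : Fin n → ℝ), lam * (ξ ⬝ᵥ ξ) ≤ ξ ⬝ᵥ (a y *ᵥ ξ)) (hbd : ∀ y i j, |a y i j| ≤ Λ)
    (hu : ContDiff ℝ 1 u) (hu1 : ∀ y, 1 ≤ u y)
    (hweak : ∀ η : EuclideanSpace ℝ (Fin n) → ℝ, ContDiff ℝ 1 η → HasCompactSupport η → tsupport η ⊆ U →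
      ∫ y, ∑ i, ∑ j, a y i j * fderiv ℝ u y (EuclideanSpace.single i 1) *
        fderiv ℝ η y (EuclideanSpace.single j 1) = 0)
    {g : ℝ → ℝ} (hg : ContDiffOn ℝ 1 g (Ioi (1 / 2)))
    {χ : EuclideanSpace ℝ (Fin n) → ℝ} (hχ : ContDiff ℝ 1 χ) (hχc : HasCompactSupport χ)
    (hχU : tsupport χ ⊆ U) :
    ∫ y, χ y ^ 2 * deriv g (u y) *
        ((fun i => fderiv ℝ u y (EuclideanSpace.single i 1)) ⬝ᵥ
          (a y *ᵥ fun i => fderiv ℝ u y (EuclideanSpace.single i 1))) =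
      -2 * ∫ y, χ y * g (u y) *
        ((fun i => fderiv ℝ u y (EuclideanSpace.single i 1)) ⬝ᵥ
          (a y *ᵥ fun j => fderiv ℝ χ y (EuclideanSpace.single j 1))) := by
  -- continuity facts
  have hcu := continuous_fderiv_single hu
  have hcχ := continuous_fderiv_single hχ
  have hgu : Continuous fun y => g (u y) :=
    (contDiff_testFun hu hu1 hg (contDiff_const (c := (1 : ℝ)))).continuous.congr fun y => by simp
  have hg'u : Continuous fun y => deriv g (u y) := by
    have hg' : ContinuousOn (deriv g) (Ioi (1 / 2)) :=
      (hg.continuousOn_deriv_of_isOpen isOpen_Ioi le_rfl)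
    refine hg'.comp_continuous hu.continuous fun y => ?_
    have := hu1 y; simp only [mem_Ioi]; linarith
  -- the test function and its gradient
  have hηU : tsupport (fun y => χ y ^ 2 * g (u y)) ⊆ U :=
    (tsupport_mul_subset_left (f := fun y => χ y ^ 2) (g := fun y => g (u y))).trans
      ((tsupport_sq_subset χ).trans hχU)
  have hη := hweak _ (contDiff_testFun hu hu1 hg hχ) (hasCompactSupport_testFun hχc) hηU
  have hpt : ∀ y, ∑ i, ∑ j, a y i j * fderiv ℝ u y (EuclideanSpace.single i 1) *
        fderiv ℝ (fun y => χ y ^ 2 * g (u y)) y (EuclideanSpace.single j 1) =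
      χ y ^ 2 * deriv g (u y) *
          ((fun i => fderiv ℝ u y (EuclideanSpace.single i 1)) ⬝ᵥ
            (a y *ᵥ fun i => fderiv ℝ u y (EuclideanSpace.single i 1))) +
        2 * (χ y * g (u y) *
          ((fun i => fderiv ℝ u y (EuclideanSpace.single i 1)) ⬝ᵥ
            (a y *ᵥ fun j => fderiv ℝ χ y (EuclideanSpace.single j 1)))) := by
    intro y
    rw [← sum_sum_mul_eq_dotProduct, ← sum_sum_mul_eq_dotProduct]
    simp only [fderiv_testFun hu hu1 hg hχ y, Finset.mul_sum, ← Finset.sum_add_distrib]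
    exact Finset.sum_congr rfl fun i _ => Finset.sum_congr rfl fun j _ => by ring
  simp_rw [hpt] at hη
  -- integrability of the two summands
  have hI1 : Integrable fun y => χ y ^ 2 * deriv g (u y) *
      ((fun i => fderiv ℝ u y (EuclideanSpace.single i 1)) ⬝ᵥ
        (a y *ᵥ fun i => fderiv ℝ u y (EuclideanSpace.single i 1))) := by
    have h := integrable_mul_of_le_continuous (n := n)
      (m := fun y => (fun i => fderiv ℝ u y (EuclideanSpace.single i 1)) ⬝ᵥ
        (a y *ᵥ fun i => fderiv ℝ u y (EuclideanSpace.single i 1)))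
      (M := fun y => n * Λ * (∑ i, fderiv ℝ u y (EuclideanSpace.single i 1) ^ 2 +
        ∑ j, fderiv ℝ u y (EuclideanSpace.single j 1) ^ 2) / 2)
      (φ := fun y => χ y ^ 2 * deriv g (u y))
      (measurable_dotProduct_mulVec hmeas hcu hcu) (by fun_prop)
      (fun y => abs_dotProduct_mulVec_le hsymm hlam hell hbd y _ _) ((hχ.continuous.pow 2).mul hg'u)
      ((hasCompactSupport_testFun (u := u) (g := deriv g) hχc))
    exact h.congr (Eventually.of_forall fun y => by ring)
  have hI2 : Integrable fun y => χ y * g (u y) *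
      ((fun i => fderiv ℝ u y (EuclideanSpace.single i 1)) ⬝ᵥ
        (a y *ᵥ fun j => fderiv ℝ χ y (EuclideanSpace.single j 1))) := by
    have h := integrable_mul_of_le_continuous (n := n)
      (m := fun y => (fun i => fderiv ℝ u y (EuclideanSpace.single i 1)) ⬝ᵥ
        (a y *ᵥ fun j => fderiv ℝ χ y (EuclideanSpace.single j 1)))
      (M := fun y => n * Λ * (∑ i, fderiv ℝ u y (EuclideanSpace.single i 1) ^ 2 +
        ∑ j, fderiv ℝ χ y (EuclideanSpace.single j 1) ^ 2) / 2)
      (φ := fun y => χ y * g (u y))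
      (measurable_dotProduct_mulVec hmeas hcu hcχ) (by fun_prop)
      (fun y => abs_dotProduct_mulVec_le hsymm hlam hell hbd y _ _) (hχ.continuous.mul hgu)
      (hχc.mul_right)
    exact h.congr (Eventually.of_forall fun y => by ring)
  rw [integral_add hI1 (hI2.const_mul 2), integral_const_mul] at hη
  linarith


/-- **Weighted Caccioppoli inequality.**  In the setting of `energy_identity_weighted_local`, if moreover `g′ > 0` on
`]½,∞[`, then `∫ χ² g′(u) Du·aDu ≤ 4 ∫ (g(u)²/g′(u)) Dχ·aDχ`. -/
theorem caccioppoli_weighted_local (hsymm : ∀ y, (a y).IsSymm) (hlam : 0 < lam)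
    (hmeas : ∀ i j, Measurable fun y => a y i j)
    (hell : ∀ y (ξ : Fin n → ℝ), lam * (ξ ⬝ᵥ ξ) ≤ ξ ⬝ᵥ (a y *ᵥ ξ)) (hbd : ∀ y i j, |a y i j| ≤ Λ)
    (hu : ContDiff ℝ 1 u) (hu1 : ∀ y, 1 ≤ u y)
    (hweak : ∀ η : EuclideanSpace ℝ (Fin n) → ℝ, ContDiff ℝ 1 η → HasCompactSupport η → tsupport η ⊆ U →
      ∫ y, ∑ i, ∑ j, a y i j * fderiv ℝ u y (EuclideanSpace.single i 1) *
        fderiv ℝ η y (EuclideanSpace.single j 1) = 0)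
    {g : ℝ → ℝ} (hg : ContDiffOn ℝ 1 g (Ioi (1 / 2))) (hg' : ∀ s, 1 / 2 < s → 0 < deriv g s)
    {χ : EuclideanSpace ℝ (Fin n) → ℝ} (hχ : ContDiff ℝ 1 χ) (hχc : HasCompactSupport χ)
    (hχU : tsupport χ ⊆ U) :
    ∫ y, χ y ^ 2 * deriv g (u y) *
        ((fun i => fderiv ℝ u y (EuclideanSpace.single i 1)) ⬝ᵥ
          (a y *ᵥ fun i => fderiv ℝ u y (EuclideanSpace.single i 1))) ≤
      4 * ∫ y, g (u y) ^ 2 / deriv g (u y) *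
        ((fun j => fderiv ℝ χ y (EuclideanSpace.single j 1)) ⬝ᵥ
          (a y *ᵥ fun j => fderiv ℝ χ y (EuclideanSpace.single j 1))) := by
  set Du : EuclideanSpace ℝ (Fin n) → Fin n → ℝ := fun y i => fderiv ℝ u y (EuclideanSpace.single i 1) with hDu
  set Dχ : EuclideanSpace ℝ (Fin n) → Fin n → ℝ := fun y j => fderiv ℝ χ y (EuclideanSpace.single j 1) with hDχ
  have hid := energy_identity_weighted_local hsymm hlam hmeas hell hbd hu hu1 hweak hg hχ hχc hχU
  have hcu := continuous_fderiv_single hu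
  have hcχ := continuous_fderiv_single hχ
  have hgu : Continuous fun y => g (u y) :=
    (contDiff_testFun hu hu1 hg (contDiff_const (c := (1 : ℝ)))).continuous.congr fun y => by simp
  have hg'u : Continuous fun y => deriv g (u y) := by
    have hg'c : ContinuousOn (deriv g) (Ioi (1 / 2)) := hg.continuousOn_deriv_of_isOpen isOpen_Ioi le_rfl
    refine hg'c.comp_continuous hu.continuous fun y => ?_
    have := hu1 y; simp only [mem_Ioi]; linarith
  have hg'pos : ∀ y, 0 < deriv g (u y) := fun y => hg' _ (by have := hu1 y; linarith)
  -- pointwise Young + Cauchy–Schwarz: `2|χ g B| ≤ ½ χ² g′ Q(Du) + 2 (g²/g′) Q(Dχ)`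
  have hpt : ∀ y, 2 * |χ y * g (u y) * (Du y ⬝ᵥ (a y *ᵥ Dχ y))| ≤
      (1 / 2) * (χ y ^ 2 * deriv g (u y) * (Du y ⬝ᵥ (a y *ᵥ Du y))) +
        2 * (g (u y) ^ 2 / deriv g (u y) * (Dχ y ⬝ᵥ (a y *ᵥ Dχ y))) := by
    intro y
    have hcs := quadForm_cauchySchwarz hsymm hlam hell y (Du y) (Dχ y)
    have hQ1 : 0 ≤ Du y ⬝ᵥ (a y *ᵥ Du y) :=
      (mul_nonneg hlam.le (Finset.sum_nonneg fun i _ => sq_nonneg (Du y i))).trans (quadForm_lower hell y _)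
    have hQ2 : 0 ≤ Dχ y ⬝ᵥ (a y *ᵥ Dχ y) :=
      (mul_nonneg hlam.le (Finset.sum_nonneg fun i _ => sq_nonneg (Dχ y i))).trans (quadForm_lower hell y _)
    have hgp := hg'pos y
    set A := (1 / 2) * (χ y ^ 2 * deriv g (u y) * (Du y ⬝ᵥ (a y *ᵥ Du y))) with hA
    set Cc := 2 * (g (u y) ^ 2 / deriv g (u y) * (Dχ y ⬝ᵥ (a y *ᵥ Dχ y))) with hC
    have hA0 : 0 ≤ A := by rw [hA]; positivity
    have hC0 : 0 ≤ Cc := by rw [hC]; positivity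
    set x := χ y * g (u y) * (Du y ⬝ᵥ (a y *ᵥ Dχ y)) with hx
    -- `x² ≤ A·Cc`
    have hx2 : x ^ 2 ≤ A * Cc := by
      have h1 : x ^ 2 = χ y ^ 2 * g (u y) ^ 2 * (Du y ⬝ᵥ (a y *ᵥ Dχ y)) ^ 2 := by rw [hx]; ring
      have h2 : A * Cc = χ y ^ 2 * g (u y) ^ 2 * ((Du y ⬝ᵥ (a y *ᵥ Du y)) * (Dχ y ⬝ᵥ (a y *ᵥ Dχ y))) := by
        rw [hA, hC]; field_simp
      rw [h1, h2]
      exact mul_le_mul_of_nonneg_left hcs (by positivity)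
    nlinarith [sq_nonneg (A - Cc), sq_abs x, abs_nonneg x, hx2]
  -- integrate
  have hI2 : Integrable fun y => χ y * g (u y) * (Du y ⬝ᵥ (a y *ᵥ Dχ y)) := by
    have h := integrable_mul_of_le_continuous (n := n) (m := fun y => Du y ⬝ᵥ (a y *ᵥ Dχ y))
      (M := fun y => n * Λ * (∑ i, Du y i ^ 2 + ∑ j, Dχ y j ^ 2) / 2) (φ := fun y => χ y * g (u y))
      (measurable_dotProduct_mulVec hmeas hcu hcχ) (by simp only [hDu, hDχ]; fun_prop)
      (fun y => abs_dotProduct_mulVec_le hsymm hlam hell hbd y _ _) (hχ.continuous.mul hgu) (hχc.mul_right)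
    exact h.congr (Eventually.of_forall fun y => by ring)
  have hIA : Integrable fun y => χ y ^ 2 * deriv g (u y) * (Du y ⬝ᵥ (a y *ᵥ Du y)) := by
    have h := integrable_mul_of_le_continuous (n := n) (m := fun y => Du y ⬝ᵥ (a y *ᵥ Du y))
      (M := fun y => n * Λ * (∑ i, Du y i ^ 2 + ∑ j, Du y j ^ 2) / 2) (φ := fun y => χ y ^ 2 * deriv g (u y))
      (measurable_dotProduct_mulVec hmeas hcu hcu) (by simp only [hDu]; fun_prop)
      (fun y => abs_dotProduct_mulVec_le hsymm hlam hell hbd y _ _) ((hχ.continuous.pow 2).mul hg'u)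
      (hasCompactSupport_testFun (u := u) (g := deriv g) hχc)
    exact h.congr (Eventually.of_forall fun y => by ring)
  have hIC : Integrable fun y => g (u y) ^ 2 / deriv g (u y) * (Dχ y ⬝ᵥ (a y *ᵥ Dχ y)) := by
    -- dominate by the continuous compactly supported `(g(u)²/g′(u)) · nΛ Σⱼ (∂ⱼχ)²`
    have hM : Integrable fun y => g (u y) ^ 2 / deriv g (u y) * (n * Λ * ∑ j, Dχ y j ^ 2) := by
      have hc : Continuous fun y => g (u y) ^ 2 / deriv g (u y) * (n * Λ * ∑ j, Dχ y j ^ 2) := by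
        refine ((hgu.pow 2).div hg'u fun y => (hg'pos y).ne').mul ?_
        simp only [hDχ]; fun_prop
      refine hc.integrable_of_hasCompactSupport ?_
      have hs : HasCompactSupport fun y => n * Λ * ∑ j, Dχ y j ^ 2 := by
        refine (hχc.fderiv (𝕜 := ℝ)).mono (Function.support_subset_iff'.2 fun y hy => ?_)
        simp only [Function.mem_support, not_not] at hy
        simp [hDχ, hy]
      exact hs.mul_left
    refine hM.mono' ?_ (Eventually.of_forall fun y => ?_)
    · exact ((hgu.pow 2).div hg'u fun y => (hg'pos y).ne').aestronglyMeasurable.mul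
        (measurable_dotProduct_mulVec hmeas hcχ hcχ).aestronglyMeasurable
    · have hq0 : 0 ≤ Dχ y ⬝ᵥ (a y *ᵥ Dχ y) :=
        (mul_nonneg hlam.le (Finset.sum_nonneg fun i _ => sq_nonneg (Dχ y i))).trans (quadForm_lower hell y _)
      have hfac : 0 ≤ g (u y) ^ 2 / deriv g (u y) := div_nonneg (sq_nonneg _) (hg'pos y).le
      rw [Real.norm_eq_abs, abs_of_nonneg (mul_nonneg hfac hq0)]
      exact mul_le_mul_of_nonneg_left (quadForm_upper hbd y _) hfac
  have hint : ∫ y, χ y ^ 2 * deriv g (u y) * (Du y ⬝ᵥ (a y *ᵥ Du y)) ≤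
      (1 / 2) * (∫ y, χ y ^ 2 * deriv g (u y) * (Du y ⬝ᵥ (a y *ᵥ Du y))) +
        2 * (∫ y, g (u y) ^ 2 / deriv g (u y) * (Dχ y ⬝ᵥ (a y *ᵥ Dχ y))) := by
    calc ∫ y, χ y ^ 2 * deriv g (u y) * (Du y ⬝ᵥ (a y *ᵥ Du y))
        = -2 * ∫ y, χ y * g (u y) * (Du y ⬝ᵥ (a y *ᵥ Dχ y)) := hid
      _ ≤ ∫ y, 2 * |χ y * g (u y) * (Du y ⬝ᵥ (a y *ᵥ Dχ y))| := by
          rw [← integral_const_mul]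
          refine integral_mono (hI2.const_mul _) (hI2.abs.const_mul 2) fun y => ?_
          have := neg_abs_le (χ y * g (u y) * (Du y ⬝ᵥ (a y *ᵥ Dχ y)))
          simp only; linarith
      _ ≤ ∫ y, ((1 / 2) * (χ y ^ 2 * deriv g (u y) * (Du y ⬝ᵥ (a y *ᵥ Du y))) +
            2 * (g (u y) ^ 2 / deriv g (u y) * (Dχ y ⬝ᵥ (a y *ᵥ Dχ y)))) :=
          integral_mono (hI2.abs.const_mul 2) ((hIA.const_mul _).add (hIC.const_mul _)) hpt
      _ = (1 / 2) * (∫ y, χ y ^ 2 * deriv g (u y) * (Du y ⬝ᵥ (a y *ᵥ Du y))) +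
            2 * (∫ y, g (u y) ^ 2 / deriv g (u y) * (Dχ y ⬝ᵥ (a y *ᵥ Dχ y))) := by
          rw [integral_add (hIA.const_mul _) (hIC.const_mul _), integral_const_mul, integral_const_mul]
  linarith


/-! ### Power Caccioppoli -/

/-- **POWER CACCIOPPOLI** (Moser 1961 (4.4)): for a `C¹` weak solution `u ≥ 1` of `div(a∇u) = 0`, `β ≠ 0` and `χ ∈ C¹_c`:
`∫ χ² u^{β−1} Du·aDu ≤ (4/β²) ∫ u^{β+1} Dχ·aDχ`. -/
theorem caccioppoli_rpow_local (hsymm : ∀ y, (a y).IsSymm) (hlam : 0 < lam)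
    (hmeas : ∀ i j, Measurable fun y => a y i j)
    (hell : ∀ y (ξ : Fin n → ℝ), lam * (ξ ⬝ᵥ ξ) ≤ ξ ⬝ᵥ (a y *ᵥ ξ)) (hbd : ∀ y i j, |a y i j| ≤ Λ)
    (hu : ContDiff ℝ 1 u) (hu1 : ∀ y, 1 ≤ u y)
    (hweak : ∀ η : EuclideanSpace ℝ (Fin n) → ℝ, ContDiff ℝ 1 η → HasCompactSupport η → tsupport η ⊆ U →
      ∫ y, ∑ i, ∑ j, a y i j * fderiv ℝ u y (EuclideanSpace.single i 1) *
        fderiv ℝ η y (EuclideanSpace.single j 1) = 0)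
    {β : ℝ} (hβ : β ≠ 0) {χ : EuclideanSpace ℝ (Fin n) → ℝ} (hχ : ContDiff ℝ 1 χ) (hχc : HasCompactSupport χ)
    (hχU : tsupport χ ⊆ U) :
    ∫ y, χ y ^ 2 * u y ^ (β - 1) *
        ((fun i => fderiv ℝ u y (EuclideanSpace.single i 1)) ⬝ᵥ
          (a y *ᵥ fun i => fderiv ℝ u y (EuclideanSpace.single i 1))) ≤
      4 / β ^ 2 * ∫ y, u y ^ (β + 1) *
        ((fun j => fderiv ℝ χ y (EuclideanSpace.single j 1)) ⬝ᵥ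
          (a y *ᵥ fun j => fderiv ℝ χ y (EuclideanSpace.single j 1))) := by
  have hupos : ∀ y, 0 < u y := fun y => lt_of_lt_of_le one_pos (hu1 y)
  have hg' : ∀ s : ℝ, 1 / 2 < s → 0 < deriv (fun s : ℝ => s ^ β / β) s := by
    intro s hs
    have hs0 : (0 : ℝ) < s := by linarith
    rw [deriv_rpow_div hβ hs0.ne']
    exact Real.rpow_pos_of_pos hs0 _
  have h := caccioppoli_weighted_local hsymm hlam hmeas hell hbd hu hu1 hweak (contDiffOn_rpow_div β) hg' hχ hχc hχU
  -- rewrite the weights: `g′(u) = u^{β−1}`, `g(u)²/g′(u) = u^{β+1}/β²`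
  have h1 : ∀ y, deriv (fun s : ℝ => s ^ β / β) (u y) = u y ^ (β - 1) := fun y => deriv_rpow_div hβ (hupos y).ne'
  have h2 : ∀ y, (u y ^ β / β) ^ 2 / u y ^ (β - 1) = (1 / β ^ 2) * u y ^ (β + 1) := by
    intro y
    have hy := hupos y
    have hr : (u y ^ β) ^ 2 = u y ^ (β + 1) * u y ^ (β - 1) := by
      rw [← Real.rpow_add hy, sq, ← Real.rpow_add hy]; congr 1; ring
    have hne : u y ^ (β - 1) ≠ 0 := (Real.rpow_pos_of_pos hy _).ne'
    rw [div_pow, hr]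
    field_simp
  simp_rw [h1, h2] at h
  calc ∫ y, χ y ^ 2 * u y ^ (β - 1) *
          ((fun i => fderiv ℝ u y (EuclideanSpace.single i 1)) ⬝ᵥ
            (a y *ᵥ fun i => fderiv ℝ u y (EuclideanSpace.single i 1)))
      ≤ 4 * ∫ y, 1 / β ^ 2 * u y ^ (β + 1) *
          ((fun j => fderiv ℝ χ y (EuclideanSpace.single j 1)) ⬝ᵥ
            (a y *ᵥ fun j => fderiv ℝ χ y (EuclideanSpace.single j 1))) := h
    _ = 4 / β ^ 2 * ∫ y, u y ^ (β + 1) *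
          ((fun j => fderiv ℝ χ y (EuclideanSpace.single j 1)) ⬝ᵥ
            (a y *ᵥ fun j => fderiv ℝ χ y (EuclideanSpace.single j 1))) := by
        rw [← integral_const_mul, ← integral_const_mul]
        congr 1; funext y; ring


/-! ### Logarithmic Caccioppoli -/

/-- **LOGARITHMIC CACCIOPPOLI** (Moser 1961 §5): for a `C¹` weak solution `u ≥ 1` and `χ ∈ C¹_c`:
`∫ χ² u^{−2} Du·aDu ≤ 4 ∫ Dχ·aDχ` (note `u^{−2} Du·aDu = D(log u)·aD(log u)`). -/
theorem caccioppoli_log_local (hsymm : ∀ y, (a y).IsSymm) (hlam : 0 < lam)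
    (hmeas : ∀ i j, Measurable fun y => a y i j)
    (hell : ∀ y (ξ : Fin n → ℝ), lam * (ξ ⬝ᵥ ξ) ≤ ξ ⬝ᵥ (a y *ᵥ ξ)) (hbd : ∀ y i j, |a y i j| ≤ Λ)
    (hu : ContDiff ℝ 1 u) (hu1 : ∀ y, 1 ≤ u y)
    (hweak : ∀ η : EuclideanSpace ℝ (Fin n) → ℝ, ContDiff ℝ 1 η → HasCompactSupport η → tsupport η ⊆ U →
      ∫ y, ∑ i, ∑ j, a y i j * fderiv ℝ u y (EuclideanSpace.single i 1) *
        fderiv ℝ η y (EuclideanSpace.single j 1) = 0)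
    {χ : EuclideanSpace ℝ (Fin n) → ℝ} (hχ : ContDiff ℝ 1 χ) (hχc : HasCompactSupport χ)
    (hχU : tsupport χ ⊆ U) :
    ∫ y, χ y ^ 2 * (u y ^ 2)⁻¹ *
        ((fun i => fderiv ℝ u y (EuclideanSpace.single i 1)) ⬝ᵥ
          (a y *ᵥ fun i => fderiv ℝ u y (EuclideanSpace.single i 1))) ≤
      4 * ∫ y, ((fun j => fderiv ℝ χ y (EuclideanSpace.single j 1)) ⬝ᵥ
          (a y *ᵥ fun j => fderiv ℝ χ y (EuclideanSpace.single j 1))) := by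
  have hupos : ∀ y, 0 < u y := fun y => lt_of_lt_of_le one_pos (hu1 y)
  have hg' : ∀ s : ℝ, 1 / 2 < s → 0 < deriv (fun s : ℝ => -s⁻¹) s := by
    intro s hs
    have hs0 : (0 : ℝ) < s := by linarith
    rw [deriv_neg_inv hs0.ne']
    positivity
  have h := caccioppoli_weighted_local hsymm hlam hmeas hell hbd hu hu1 hweak contDiffOn_neg_inv hg' hχ hχc hχU
  have h1 : ∀ y, deriv (fun s : ℝ => -s⁻¹) (u y) = (u y ^ 2)⁻¹ := fun y => deriv_neg_inv (hupos y).ne'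
  have h2 : ∀ y, (-(u y)⁻¹) ^ 2 / (u y ^ 2)⁻¹ = 1 := by
    intro y
    have hy := (hupos y).ne'
    field_simp
  simp_rw [h1, h2, one_mul] at h
  exact h


end Summit.NavierStokesRegularity.NavierStokesRegularity.Theorems.PoloidalWindowDoorPoloidalWindowRigidityDivFormLocalCaccioppoli

end
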